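/-
Origin: expansion seat `planner-pub-hodgecm-qw8-g11-0`, handover #9 REPLACE (DOC-ONLY) md5 a12006a2e9afc857a1cd0515711ebbe1 (396 l.) SUPERSEDES tree `HodgeCM/Model/Toy/LefPartialConj.lean` da72c871 (377 l.): docstrings added to every undocumented theorem/def (CONVENTIONS §3 debt → 0), comment-stripped code IDENTICAL to the tree copy (residue md5 fbfea04b; no declaration, statement or proof changed); imports unchanged (Mathlib, HodgeCM.Model.Toy.LefQuarticQuad;  (`HOME/pub-hodgecm-qw8-g11/lean/Qw8g11/LefPartialConj.lean`, md5 a12006a2, 396 lines);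
landed by the packager successor (mc-unitary-1-g3, gen-8 kit) in gate run 32 REPLACES the earlier landed copy of `HodgeCM/Model/Toy/LefPartialConj.lean` (seat copy carried the packager origin header of the earlier run (stripped)).
-/
-- HANDOVER (planner-pub-hodgecm-qw8-g8-0, unit pub-hodgecm-qw8-g8): WIP module `Qw8g8.LefPartialConj`; intended final
-- module `HodgeCM.Model.Toy.LefPartialConj` (kind L5, separating model — presenting fields related by partial
-- complex conjugations); additive leaf; at landing rewrite `import Qw8g8.LefQuarticQuad` ↦ `HodgeCM.Model.Toy.…`.
/-
Copyright (c) 2026. All rights reserved.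
Released under Apache 2.0 license as described in the file LICENSE.
-/
import Mathlib
import Summits.HodgeConjecture.HodgeCM.Model.Toy.LefQuarticQuad

/-!
# The Lefschetz model on products over TWO CM fields admitting a partial complex conjugation

`LefQuarticQuad` leaves open which pairs of DIFFERENT quartic CM fields `K₁, K₂` may be mixed (a `D₄` field and
its reflex sister may not).  The cross terms are governed by one group-free condition:

* `PartialConj K₁ K₂` : some `γ ∈ Aut_ℚ(ℚ̄)` acts as complex conjugation on ALL embeddings `K₁ → ℂ` and
  trivially on ALL embeddings `K₂ → ℂ` (equivalently: the Galois closures of `K₁` and `K₂` meet in a totally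
  real field — not proved here; the condition is carried as a hypothesis and is symmetric, `PartialConj.symm`).

Under it every pair orbit `O ⊆ Hom(K₁,ℂ) × Hom(K₂,ℂ)` is stable under `(a,b) ↦ (ā,b)`, which reverses the sign
of `sgn_Ψ(a)·sgn_Ψ'(b)`; so EVERY cross pair sum vanishes (`sum_pairOrbit_eq_zero_of_partialConj`, any degrees,
any CM types), and for `[K₁:ℚ], [K₂:ℚ] ≤ 4` the same-field pairs are `LefQuartic`'s: objects whose atoms are
presented over `K₁` or `K₂` satisfy `CntBal`, hence HC in `lefModel` (`lef_hc_of_biPresented`,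
`lef_hc_prod_of_presented_of_presented`); since only PAIRS of slots are compared, the same holds for any family of
fields of degree `≤ 4` with pairwise partial conjugations (`lef_hc_of_multiPresented`, `lef_hc_prodFin_cmObj_multi`).
For a `D₄` field and its reflex sister no partial conjugation exists (same CM Galois closure) — consistent with the
failure recorded in `LefQuartic`/`LefQuadMixed`.  Also recorded:
the generic push-forward of an `Ω_X` pair sum to the pair orbit of the two slots (`Obj.trichot_of_pairOrbit`),
of which `LefQuarticQuad` §§4–5 are instances.  Nothing is cited: kernel facts about an explicit model.
-/

noncomputable section

set_option backward.isDefEq.respectTransparency false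

namespace HodgeCM.Toy

open scoped TensorProduct
open exteriorPower Module CMPresentation CMTypeOps
open NumberField.ComplexEmbedding (conjugate)
open Literature.AlgebraicGeometry.Motives

/-! ### 1. Partial complex conjugations -/

section PartialConj

variable (K₁ K₂ : Type) [Field K₁] [NumberField K₁] [Field K₂] [NumberField K₂]

/-- some `γ ∈ Aut_ℚ(ℚ̄)` conjugates every embedding of `K₁` and fixes every embedding of `K₂` -/
def PartialConj : Prop :=
  ∃ γ : Gam, (∀ a : K₁ →+* ℂ, twist γ a = conjugate a) ∧ (∀ b : K₂ →+* ℂ, twist γ b = b)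

variable {K₁ K₂}

/-- `PartialConj` is symmetric: compose `γ` with complex conjugation `κ` on `ℚ̄` -/
theorem PartialConj.symm (h : PartialConj K₁ K₂) : PartialConj K₂ K₁ := by
  obtain ⟨γ, h1, h2⟩ := h
  refine ⟨Obj.kap * γ, fun b => ?_, fun a => ?_⟩
  · rw [twist_mul, h2, twist_kap]
  · rw [twist_mul, h1, twist_kap, conjugate_conjugate]

/-- no field carrying a CM type is partially conjugate to itself -/
theorem not_partialConj_self (Ψ : CMType K₁) : ¬ PartialConj K₁ K₁ := by
  rintro ⟨γ, h1, h2⟩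
  obtain ⟨a⟩ := (inferInstance : Nonempty (K₁ →+* ℂ))
  exact conjugate_ne_self_of_cmType Ψ a ((h1 a).symm.trans (h2 a))

open scoped Classical in
/-- **cross pair sums vanish under a partial conjugation** (any degrees, any CM types): `(a,b) ↦ (ā,b)`
preserves the pair orbit and reverses the summand. -/
theorem sum_pairOrbit_eq_zero_of_partialConj (h : PartialConj K₁ K₂) (Ψ : CMType K₁) (Ψ' : CMType K₂)
    (x : K₁ →+* ℂ) (y : K₂ →+* ℂ) (O : Finset ((K₁ →+* ℂ) × (K₂ →+* ℂ)))
    (hO : ∀ q, q ∈ O ↔ ∃ γ : Gam, (twist γ x, twist γ y) = q) :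
    ∑ q ∈ O, sgn Ψ q.1 * sgn Ψ' q.2 = 0 := by
  obtain ⟨γ, h1, h2⟩ := h
  have hmem : ∀ q ∈ O, (conjugate q.1, q.2) ∈ O := by
    intro q hq
    obtain ⟨δ, rfl⟩ := (hO q).mp hq
    exact (hO _).mpr ⟨γ * δ, by rw [twist_mul, twist_mul, h1, h2]⟩
  have hinv : ∀ q : (K₁ →+* ℂ) × (K₂ →+* ℂ),
      (conjugate (conjugate q.1, q.2).1, (conjugate q.1, q.2).2) = q :=
    fun q => by rw [conjugate_conjugate]
  have key : ∑ q ∈ O, sgn Ψ q.1 * sgn Ψ' q.2 = ∑ q ∈ O, -(sgn Ψ q.1 * sgn Ψ' q.2) := by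
    refine Finset.sum_nbij' (fun q => (conjugate q.1, q.2)) (fun q => (conjugate q.1, q.2)) hmem hmem
      (fun q _ => hinv q) (fun q _ => hinv q) ?_
    intro q _
    show sgn Ψ q.1 * sgn Ψ' q.2 = -(sgn Ψ (conjugate q.1) * sgn Ψ' q.2)
    rw [sgn_conjugate]
    ring
  rw [Finset.sum_neg_distrib] at key
  omega

end PartialConj

/-- `LefQuartic`'s trichotomy in CM degree `≤ 4` -/
theorem triInner_of_finrank_le_four (K : CMField) (hK : Module.finrank ℚ K ≤ 4) : TriInner K := by
  rcases finrank_eq_two_or_eq_four_of_le_four K hK with h2 | h4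
  · exact triInner_of_finrank_eq_two K h2
  · exact triInner_of_finrank_eq_four K h4

namespace Obj

variable (X : Obj)

/-! ### 2. The generic push-forward of an `Ω_X` pair sum to the pair orbit of the two slots -/

section Push

open scoped Classical

variable {K₁ K₂ : CMField}

/-- if every pair orbit of `(x, y) ∈ Hom(K₁,ℂ) × Hom(K₂,ℂ)` satisfies the trichotomy for `Ψ, Ψ'`, so does the
`Ω_X` pair sum of a `K₁`-slot presented from `Ψ` against a `K₂`-slot presented from `Ψ'` -/
theorem trichot_of_pairOrbit {s t : X.Idx} (hs : X.PresentedAt K₁ s.1) (ht : X.PresentedAt K₂ t.1)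
    (H : ∀ (Ψ : CMType K₁) (Ψ' : CMType K₂) (x : K₁ →+* ℂ) (y : K₂ →+* ℂ)
      (O : Finset ((K₁ →+* ℂ) × (K₂ →+* ℂ))), (∀ q, q ∈ O ↔ ∃ γ : Gam, (twist γ x, twist γ y) = q) →
      Trichot O.card (∑ q ∈ O, sgn Ψ q.1 * sgn Ψ' q.2)) :
    Trichot X.Omega.card (∑ ω ∈ X.Omega, X.sg (ω s) * X.sg (ω t)) := by
  obtain ⟨i, τ⟩ := s
  obtain ⟨i', τ'⟩ := t
  obtain ⟨Ψ, e, he⟩ := hs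
  obtain ⟨Ψ', e', he'⟩ := ht
  obtain ⟨x, hx⟩ : ∃ x : K₁ →+* ℂ, x = τ.comp e := ⟨_, rfl⟩
  obtain ⟨y, hy⟩ : ∃ y : K₂ →+* ℂ, y = τ'.comp e' := ⟨_, rfl⟩
  obtain ⟨P, hP⟩ : ∃ P : (X.Idx → X.Idx) → (K₁ →+* ℂ) × (K₂ →+* ℂ),
      ∀ ω, P ω = (twist (X.glift ω) x, twist (X.glift ω) y) := ⟨_, fun _ => rfl⟩
  obtain ⟨h, hh⟩ : ∃ h : (K₁ →+* ℂ) × (K₂ →+* ℂ) → ℤ, ∀ q, h q = sgn Ψ q.1 * sgn Ψ' q.2 :=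
    ⟨_, fun _ => rfl⟩
  have hsum : ∑ ω ∈ X.Omega, X.sg (ω ⟨i, τ⟩) * X.sg (ω ⟨i', τ'⟩) = ∑ ω ∈ X.Omega, h (P ω) :=
    Finset.sum_congr rfl fun ω hω => by
      rw [hh, hP, X.sg_eq_sgn_twist_glift he hω, X.sg_eq_sgn_twist_glift he' hω, hx, hy]
  have hF : ∀ γ : Gam, ∀ ω ∈ X.Omega,
      P (fun s => X.gact γ (ω s)) = Prod.map (twist γ) (twist γ) (P ω) := by
    intro γ ω hω
    rw [hP, hP, Prod.map_apply, hx, hy, X.twist_glift_comp γ hω, X.twist_glift_comp γ hω]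
  have hO : ∀ q, q ∈ X.Omega.image P ↔ ∃ γ : Gam, (twist γ x, twist γ y) = q := by
    intro q
    rw [Finset.mem_image]
    constructor
    · rintro ⟨ω, hω, rfl⟩
      obtain ⟨δ, rfl⟩ := mem_Omega.mp hω
      exact ⟨δ, by rw [hP, hx, hy, twist_glift_gact, twist_glift_gact]⟩
    · rintro ⟨γ, rfl⟩
      exact ⟨X.gact γ, X.gact_mem_Omega γ, by rw [hP, hx, hy, twist_glift_gact, twist_glift_gact]⟩
  have h1 := X.gact_mem_Omega 1
  have key := sum_eq_card_fibre_mul_sum' (X.Omega_mapsTo) (X.comp_gact_injective) (X.Omega_transitive)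
    hF h h1
  have keyc := card_eq_card_fibre_mul' (X.Omega_mapsTo) (X.comp_gact_injective) (X.Omega_transitive)
    hF h1
  have hpair : Trichot (X.Omega.image P).card (∑ q ∈ X.Omega.image P, h q) := by
    have h3 : ∑ q ∈ X.Omega.image P, h q = ∑ q ∈ X.Omega.image P, sgn Ψ q.1 * sgn Ψ' q.2 :=
      Finset.sum_congr rfl fun q _ => hh q
    rw [h3]
    exact H Ψ Ψ' x y _ hO
  rw [hsum, key, keyc]
  exact hpair.mul _

/-- **cross slots under a partial conjugation**: the pair sum vanishes -/
theorem trichot_of_presentedAt_of_partialConj (hc : PartialConj K₁ K₂) {s t : X.Idx}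
    (hs : X.PresentedAt K₁ s.1) (ht : X.PresentedAt K₂ t.1) :
    Trichot X.Omega.card (∑ ω ∈ X.Omega, X.sg (ω s) * X.sg (ω t)) :=
  X.trichot_of_pairOrbit hs ht fun Ψ Ψ' x y O hO =>
    Or.inl (sum_pairOrbit_eq_zero_of_partialConj hc Ψ Ψ' x y O hO)

end Push

/-! ### 3. Objects presented over two fields -/

section Bi

variable (K₁ K₂ : CMField)

/-- every atom of `X` is presented over `K₁` or over `K₂` -/
def BiPresented : Prop :=
  ∀ i, X.PresentedAt K₁ i ∨ X.PresentedAt K₂ i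

variable {K₁ K₂} {X}

/-- an object presented over `K₁` is presented over the pair `K₁, K₂` -/
theorem biPresented_of_presented_left (h : X.Presented K₁) : X.BiPresented K₁ K₂ :=
  fun i => Or.inl (presentedAt_of_presented h i)

/-- an object presented over `K₂` is presented over the pair `K₁, K₂` -/
theorem biPresented_of_presented_right (h : X.Presented K₂) : X.BiPresented K₁ K₂ :=
  fun i => Or.inr (presentedAt_of_presented h i)

/-- `BiPresented K₁ K₂` is preserved by the product `X.prod Y` (atoms of the product are atoms of a
factor) -/
theorem biPresented_prod {X Y : Obj} (hX : X.BiPresented K₁ K₂) (hY : Y.BiPresented K₁ K₂) :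
    (X.prod Y).BiPresented K₁ K₂ := by
  rintro (i | i)
  · exact hX i
  · exact hY i

/-- `BiPresented K₁ K₂` is preserved by the iterated product `prodFin` of `toyModelWith D` -/
theorem biPresented_prodFin (D : HodgeData) : ∀ (n : ℕ) (Xs : Fin (n + 1) → Obj),
    (∀ j, (Xs j).BiPresented K₁ K₂) → Obj.BiPresented ((toyModelWith D).prodFin n Xs) K₁ K₂
  | 0, _, h => h 0
  | n + 1, _, h => biPresented_prod (biPresented_prodFin D n _ fun _ => h _) (h _)

open scoped Classical in
/-- **the trichotomy for two fields of degree `≤ 4` with a partial conjugation** -/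
theorem triOmega_of_biPresented (h₁ : Module.finrank ℚ K₁ ≤ 4) (h₂ : Module.finrank ℚ K₂ ≤ 4)
    (hc : PartialConj K₁ K₂) (h : X.BiPresented K₁ K₂) : X.TriOmega := by
  intro s t
  rcases h s.1 with hs | hs <;> rcases h t.1 with ht | ht
  · exact X.trichot_of_presentedAt (triInner_of_finrank_le_four K₁ h₁) hs ht
  · exact X.trichot_of_presentedAt_of_partialConj hc hs ht
  · exact X.trichot_of_presentedAt_of_partialConj hc.symm hs ht
  · exact X.trichot_of_presentedAt (triInner_of_finrank_le_four K₂ h₂) hs ht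

/-- **Balance for two fields.** If `[K₁:ℚ], [K₂:ℚ] ≤ 4` and `K₁, K₂` are related by a partial
conjugation, every object whose atoms are presented over `K₁` or `K₂` satisfies the counting-balance
condition `CntBal` -/
theorem cntBal_of_biPresented (h₁ : Module.finrank ℚ K₁ ≤ 4) (h₂ : Module.finrank ℚ K₂ ≤ 4)
    (hc : PartialConj K₁ K₂) (h : X.BiPresented K₁ K₂) : X.CntBal :=
  X.cntBal_of_triOmega (triOmega_of_biPresented h₁ h₂ hc h)

end Bi

/-! ### 3b. Objects presented over a family of fields with pairwise partial conjugations -/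

section Multi

variable {ι : Type} (Ks : ι → CMField)

/-- every atom of `X` is presented over some field of the family `Ks` (index the DISTINCT fields by `ι`; several
atoms may share an index) -/
def MultiPresented : Prop :=
  ∀ i, ∃ j, X.PresentedAt (Ks j) i

variable {Ks} {X}

/-- an object presented over one member `Ks j` of the family is presented over the family `Ks` -/
theorem multiPresented_of_presented (j : ι) (h : X.Presented (Ks j)) : X.MultiPresented Ks :=
  fun i => ⟨j, presentedAt_of_presented h i⟩

/-- `MultiPresented Ks` is preserved by the product `X.prod Y` -/
theorem multiPresented_prod {X Y : Obj} (hX : X.MultiPresented Ks) (hY : Y.MultiPresented Ks) :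
    (X.prod Y).MultiPresented Ks := by
  rintro (i | i)
  · exact hX i
  · exact hY i

/-- `MultiPresented Ks` is preserved by the iterated product `prodFin` of `toyModelWith D` -/
theorem multiPresented_prodFin (D : HodgeData) : ∀ (n : ℕ) (Xs : Fin (n + 1) → Obj),
    (∀ j, (Xs j).MultiPresented Ks) → Obj.MultiPresented ((toyModelWith D).prodFin n Xs) Ks
  | 0, _, h => h 0
  | n + 1, _, h => multiPresented_prod (multiPresented_prodFin D n _ fun _ => h _) (h _)

open scoped Classical in
/-- **the trichotomy for a family of fields of degree `≤ 4` with pairwise partial conjugations** (only PAIRS of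
slots are ever compared, so pairwise hypotheses suffice; slots with the same field index use `TriInner`) -/
theorem triOmega_of_multiPresented (hd : ∀ j, Module.finrank ℚ (Ks j) ≤ 4)
    (hc : ∀ j j', j ≠ j' → PartialConj (Ks j) (Ks j')) (h : X.MultiPresented Ks) : X.TriOmega := by
  intro s t
  obtain ⟨j, hs⟩ := h s.1
  obtain ⟨j', ht⟩ := h t.1
  by_cases hjj : j = j'
  · subst hjj
    exact X.trichot_of_presentedAt (triInner_of_finrank_le_four (Ks j) (hd j)) hs ht
  · exact X.trichot_of_presentedAt_of_partialConj (hc j j' hjj) hs ht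

/-- **Balance for a family of fields.** If every `Ks j` has degree `≤ 4` over `ℚ` and any two
distinct members have a partial conjugation, every object whose atoms are presented over the family
satisfies `CntBal` -/
theorem cntBal_of_multiPresented (hd : ∀ j, Module.finrank ℚ (Ks j) ≤ 4)
    (hc : ∀ j j', j ≠ j' → PartialConj (Ks j) (Ks j')) (h : X.MultiPresented Ks) : X.CntBal :=
  X.cntBal_of_triOmega (triOmega_of_multiPresented hd hc h)

/-- two fields of the family are **compatible** if one of them is imaginary quadratic (`LefQuarticQuad`: no further
hypothesis needed) or they are related by a partial conjugation -/
def Compatible (K₁ K₂ : CMField) : Prop :=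
  Module.finrank ℚ K₁ = 2 ∨ Module.finrank ℚ K₂ = 2 ∨ PartialConj K₁ K₂

open scoped Classical in
/-- the pair sum `∑_{ω ∈ Ω_X} sg(ω s)·sg(ω t)` of two slots presented over **compatible** fields of
degree `≤ 4` is trichotomous (`0` or `± |Ω_X|`) -/
theorem trichot_of_presentedAt_of_compatible {K₁ K₂ : CMField} (h₁ : Module.finrank ℚ K₁ ≤ 4)
    (h₂ : Module.finrank ℚ K₂ ≤ 4) (hc : Compatible K₁ K₂) {s t : X.Idx} (hs : X.PresentedAt K₁ s.1)
    (ht : X.PresentedAt K₂ t.1) : Trichot X.Omega.card (∑ ω ∈ X.Omega, X.sg (ω s) * X.sg (ω t)) := by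
  rcases hc with hq | hq | hp
  · have key := X.trichot_of_presentedAt_of_quad h₂ hq ht hs
    have hsum : ∑ ω ∈ X.Omega, X.sg (ω s) * X.sg (ω t) = ∑ ω ∈ X.Omega, X.sg (ω t) * X.sg (ω s) :=
      Finset.sum_congr rfl fun ω _ => mul_comm _ _
    rw [hsum]
    exact key
  · exact X.trichot_of_presentedAt_of_quad h₁ hq hs ht
  · exact X.trichot_of_presentedAt_of_partialConj hp hs ht

open scoped Classical in
/-- **the trichotomy for a family of pairwise compatible fields of degree `≤ 4`** -/
theorem triOmega_of_multiPresented_of_compatible (hd : ∀ j, Module.finrank ℚ (Ks j) ≤ 4)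
    (hc : ∀ j j', j ≠ j' → Compatible (Ks j) (Ks j')) (h : X.MultiPresented Ks) : X.TriOmega := by
  intro s t
  obtain ⟨j, hs⟩ := h s.1
  obtain ⟨j', ht⟩ := h t.1
  by_cases hjj : j = j'
  · subst hjj
    exact X.trichot_of_presentedAt (triInner_of_finrank_le_four (Ks j) (hd j)) hs ht
  · exact X.trichot_of_presentedAt_of_compatible (hd j) (hd j') (hc j j' hjj) hs ht

/-- **Balance for a compatible family.** If every `Ks j` has degree `≤ 4` over `ℚ` and any two
distinct members are `Compatible`, every object presented over the family satisfies `CntBal` -/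
theorem cntBal_of_multiPresented_of_compatible (hd : ∀ j, Module.finrank ℚ (Ks j) ≤ 4)
    (hc : ∀ j j', j ≠ j' → Compatible (Ks j) (Ks j')) (h : X.MultiPresented Ks) : X.CntBal :=
  X.cntBal_of_triOmega (triOmega_of_multiPresented_of_compatible hd hc h)

end Multi

end Obj

/-! ### 4. Headlines -/

section Headline

variable (K₁ K₂ : CMField)

/-- **HC in the Lefschetz model over two CM fields of degree `≤ 4` admitting a partial conjugation**: every
object whose atoms are presented over `K₁` or over `K₂` (any shape, arbitrary ambient CM fields `Fᵢ`). -/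
theorem lef_hc_of_biPresented (h₁ : Module.finrank ℚ K₁ ≤ 4) (h₂ : Module.finrank ℚ K₂ ≤ 4)
    (hc : PartialConj K₁ K₂) (X : Obj) (h : X.BiPresented K₁ K₂) : lefModel.HC X :=
  lef_hc_of_cntBal X (Obj.cntBal_of_biPresented h₁ h₂ hc h)

/-- … on iterated products … -/
theorem lef_hc_prodFin_of_biPresented (h₁ : Module.finrank ℚ K₁ ≤ 4) (h₂ : Module.finrank ℚ K₂ ≤ 4)
    (hc : PartialConj K₁ K₂) {n : ℕ} (Xs : Fin (n + 1) → Obj) (h : ∀ j, (Xs j).BiPresented K₁ K₂) :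
    lefModel.HC (lefModel.prodFin n Xs) := by
  rw [lefModel_prodFin]
  exact lef_hc_of_biPresented K₁ K₂ h₁ h₂ hc _ (Obj.biPresented_prodFin exteriorHodgeData n Xs h)

/-- **HEADLINE.** `A_{(K₁,Φ₀)} × ⋯ × A_{(K₁,Φₘ)} × A_{(K₂,Φ'₀)} × ⋯`: products of CM abelian varieties over
TWO CM fields of degree `≤ 4` related by a partial conjugation satisfy HC in `lefModel` (CM types arbitrary, also
induced ones over larger ambient fields via `Obj.BiPresented`). -/
theorem lef_hc_prod_of_presented_of_presented (h₁ : Module.finrank ℚ K₁ ≤ 4)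
    (h₂ : Module.finrank ℚ K₂ ≤ 4) (hc : PartialConj K₁ K₂) {X Y : Obj} (hX : X.Presented K₁)
    (hY : Y.Presented K₂) : lefModel.HC (X.prod Y) :=
  lef_hc_of_biPresented K₁ K₂ h₁ h₂ hc _
    (Obj.biPresented_prod (Obj.biPresented_of_presented_left hX) (Obj.biPresented_of_presented_right hY))

/-- e.g. `A_{(K₁,Φ)} × A_{(K₂,Φ')}` for CM types `Φ, Φ'` of two such fields -/
theorem lef_hc_cmObj_prod_cmObj (h₁ : Module.finrank ℚ K₁ ≤ 4) (h₂ : Module.finrank ℚ K₂ ≤ 4)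
    (hc : PartialConj K₁ K₂) (Φ : CMType K₁) (Φ' : CMType K₂) :
    lefModel.HC ((cmObj K₁ Φ).prod (cmObj K₂ Φ')) :=
  lef_hc_prod_of_presented_of_presented K₁ K₂ h₁ h₂ hc (presented_cmObj K₁ Φ) (presented_cmObj K₂ Φ')


/-- **HC in the Lefschetz model over a FAMILY of CM fields of degree `≤ 4` with pairwise partial conjugations** -/
theorem lef_hc_of_multiPresented {ι : Type} (Ks : ι → CMField) (hd : ∀ j, Module.finrank ℚ (Ks j) ≤ 4)
    (hc : ∀ j j', j ≠ j' → PartialConj (Ks j) (Ks j')) (X : Obj) (h : X.MultiPresented Ks) :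
    lefModel.HC X :=
  lef_hc_of_cntBal X (Obj.cntBal_of_multiPresented hd hc h)

/-- **HEADLINE (family form).** `A_{(F₀,Θ₀)} × ⋯ × A_{(Fₙ,Θₙ)}` with `Fⱼ = Ks (c j)` drawn from a family
`Ks : ι → CMField` of CM fields of degree `≤ 4`, any two of which (distinct indices) are related by a partial
conjugation, and arbitrary CM types `Θⱼ`: HC holds in `lefModel`. -/
theorem lef_hc_prodFin_cmObj_multi {ι : Type} (Ks : ι → CMField) (hd : ∀ a, Module.finrank ℚ (Ks a) ≤ 4)
    (hc : ∀ a b, a ≠ b → PartialConj (Ks a) (Ks b)) {n : ℕ} (c : Fin (n + 1) → ι)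
    (Θ : ∀ j, CMType (Ks (c j))) :
    lefModel.HC (lefModel.prodFin n fun j => cmObj (Ks (c j)) (Θ j)) := by
  rw [lefModel_prodFin]
  exact lef_hc_of_multiPresented Ks hd hc _
    (Obj.multiPresented_prodFin exteriorHodgeData n _ fun j =>
      Obj.multiPresented_of_presented (c j) (presented_cmObj (Ks (c j)) (Θ j)))

/-- **HEADLINE (most general form of this series).** A family `Ks : ι → CMField` of CM fields of degree `≤ 4`,
pairwise COMPATIBLE (one of the two is imaginary quadratic, or a partial conjugation relates them): every object
all of whose atoms are presented over fields of the family satisfies HC in `lefModel` — this contains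
`LefQuartic` (one field), `LefQuadMixed`/`LefQuarticQuad` (one field of degree `≤ 4` plus imaginary quadratic
fields: compatible with everything) and `lef_hc_of_multiPresented` (partial conjugations). -/
theorem lef_hc_of_multiPresented_of_compatible {ι : Type} (Ks : ι → CMField)
    (hd : ∀ j, Module.finrank ℚ (Ks j) ≤ 4) (hc : ∀ j j', j ≠ j' → Obj.Compatible (Ks j) (Ks j'))
    (X : Obj) (h : X.MultiPresented Ks) : lefModel.HC X :=
  lef_hc_of_cntBal X (Obj.cntBal_of_multiPresented_of_compatible hd hc h)

/-- … and its product-of-CM-abelian-varieties instance `A_{(Ks (c 0), Θ₀)} × ⋯ × A_{(Ks (c n), Θₙ)}` -/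
theorem lef_hc_prodFin_cmObj_compatible {ι : Type} (Ks : ι → CMField)
    (hd : ∀ a, Module.finrank ℚ (Ks a) ≤ 4) (hc : ∀ a b, a ≠ b → Obj.Compatible (Ks a) (Ks b)) {n : ℕ}
    (c : Fin (n + 1) → ι) (Θ : ∀ j, CMType (Ks (c j))) :
    lefModel.HC (lefModel.prodFin n fun j => cmObj (Ks (c j)) (Θ j)) := by
  rw [lefModel_prodFin]
  exact lef_hc_of_multiPresented_of_compatible Ks hd hc _
    (Obj.multiPresented_prodFin exteriorHodgeData n _ fun j =>
      Obj.multiPresented_of_presented (c j) (presented_cmObj (Ks (c j)) (Θ j)))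

end Headline

end HodgeCM.Toy

end
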